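import Literature.AlgebraicGeometry.Resolution.HypersurfaceHeightTwoWeightedCentre
import Summits.ResolutionOfSingularities.ResolutionOfSingularities.Theorems.WeightedInvariantHypersurfaceCentreAlgebraize
import HarnessLib

/-!
# The competitor lemma for the lex-maximal weighted centre germ (door `HypersurfaceCentreConstruction`, (o25-β), part 2a)

Topic: `Summits/ResolutionOfSingularities/ResolutionOfSingularities/Theorems`. Helper for the door item
`HypersurfaceCentreConstruction` (statement `stmt-ResolutionOfSingularities-19897`, route `WeightedInvariant`), line
`local-engine` of `res-L1-w43-plan-1`, ORDER (o25-β) (DEALS gen 9 #21, 2026-08-27T09:27:57Z): the elementary half of the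
local-algebra form of Abramovich–Quek–Schober 2025 Thm 1.3 (3) — what LEX-MAXIMALITY of the weighted centre germ
(`IsLexMaxWeightedCentreGerm`, `Literature/…/HypersurfaceHeightTwoWeightedCentre.lean`) forbids. Consumed by
`…LexMaxOrderDrop` (part 2b, the order drop on `B₊`).

[OURS · L1 W4.3] Replaces the role of NO printed item of the manuscript under review [claim: Hironaka2017,
status: under-review]; it is the kernel form of step (b) in the proof of Abramovich–Quek–Schober 2025 Thm 3.5
(arXiv:2507.01232v3): «if all monomials other than `y^ν` lie strictly above the line, a steeper admissible centre exists».
AI work, weaker than expert review.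

## Contents

* `mem_weightedMonomialIdeal_competitor` — **the competitor lemma**: `f ≡ c·y₀^ν (mod 𝒥_{w₀ν+1}(y; w))` implies
  `f ∈ 𝒥_{(νw₀+1)ν}(y; (νw₀+1, νw₁))`, an admissible datum with the same `a₁ = ν` and a larger `a₂`;
* `not_prepared_of_isLexMax` — hence the lex-maximal germ with `ℓ = w₀ν` is prepared in NO regular system of parameters;
* `sum_face_reindex` — for coprime `w₀, w₁` the face `w·α = w₀ν` of an exponent set is `{(ν - w₁j, w₀j)}`, as a
  reindexing identity of finite sums.

## References

* D. Abramovich, M. H. Quek, B. Schober, *Torus actions, weighted blow-ups, and desingularization of plane curves*,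
  arXiv:2507.01232 (v3, 2026), Thm 3.5. [AbramovichQuekSchober2025]
* J. Włodarczyk, *Functorial resolution by torus actions*, arXiv:2203.03090, §2.3.9. [Wlodarczyk2022]
-/

noncomputable section

open IsLocalRing Literature.AlgebraicGeometry.Resolution

set_option linter.dupNamespace false -- mandated namespace of this single-conjunct summit

namespace Summit.ResolutionOfSingularities.ResolutionOfSingularities.Theorems

namespace LexMaxOrderDrop

variable {S : Type} [CommRing S]

/-! ### Weights of monomials -/

/-- `y 0 ^ ν` has `w`-weight `w 0 · ν`. [folklore] -/
theorem pow_fst_mem (y : Fin 2 → S) (w : Fin 2 → ℕ) (ν : ℕ) :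
    y 0 ^ ν ∈ weightedMonomialIdeal y w (w 0 * ν) := by
  have h := prod_pow_mem_weightedMonomialIdeal y w (n := w 0 * ν) (Pi.single 0 ν) (by simp [Fin.sum_univ_two])
  simpa [Fin.prod_univ_two] using h

/-! ### The competitor lemma -/

/-- **The COMPETITOR LEMMA.** If `f ≡ c·y₀^ν` modulo `𝒥_{w₀ν+1}(y; w)` (all other monomials of `f` lie STRICTLY above the
line `w·α = w₀ν`), then `f` is admissible for the steeper weighted datum `(y; (νw₀+1, νw₁); (νw₀+1)ν)`:
monomial by monomial, `w·α ≥ w₀ν + 1 ⇒ (νw₀+1)α₀ + νw₁α₁ = ν(w·α) + α₀ ≥ νw₀ν + ν`. [cite: AbramovichQuekSchober2025, Thm 3.5 (proof (b))] -/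
theorem mem_weightedMonomialIdeal_competitor (y : Fin 2 → S) (w : Fin 2 → ℕ) {ν : ℕ} {f c : S}
    (hprep : f - c * y 0 ^ ν ∈ weightedMonomialIdeal y w (w 0 * ν + 1)) :
    f ∈ weightedMonomialIdeal y ![ν * w 0 + 1, ν * w 1] ((ν * w 0 + 1) * ν) := by
  have hle : weightedMonomialIdeal y w (w 0 * ν + 1) ≤ weightedMonomialIdeal y ![ν * w 0 + 1, ν * w 1] ((ν * w 0 + 1) * ν) := by
    rw [weightedMonomialIdeal, Ideal.span_le]
    rintro _ ⟨α, hα, rfl⟩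
    refine prod_pow_mem_weightedMonomialIdeal y _ α ?_
    simp only [Fin.sum_univ_two, Matrix.cons_val_zero, Matrix.cons_val_one] at hα ⊢
    have h2 := Nat.mul_le_mul_left ν hα
    nlinarith [h2, Nat.zero_le (α 0), Nat.zero_le (w 0 * α 0), Nat.zero_le (w 1 * α 1)]
  have hy : c * y 0 ^ ν ∈ weightedMonomialIdeal y ![ν * w 0 + 1, ν * w 1] ((ν * w 0 + 1) * ν) := by
    refine Ideal.mul_mem_left _ _ ?_
    have h := pow_fst_mem y ![ν * w 0 + 1, ν * w 1] ν
    simpa using h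
  have := Ideal.add_mem _ (hle hprep) hy
  rwa [sub_add_cancel] at this

/-- **Lex-maximality forbids a prepared position.** If `(x; w; ℓ)` is the lex-maximal centre germ of `(f)` with
`ℓ = w₀ν` (`ν ≥ 1`), then NO regular system of parameters `y` has `f ≡ c·y₀^ν (mod 𝒥_{w₀ν+1}(y; w))`: the competitor datum
`(y; (νw₀+1, νw₁); (νw₀+1)ν)` is admissible with `a₁' = a₁` and `a₂' > a₂`. [cite: AbramovichQuekSchober2025, Thm 3.5] -/
theorem not_prepared_of_isLexMax [IsLocalRing S] {f : S} {x : Fin 2 → S} {w : Fin 2 → ℕ} {ℓ ν : ℕ}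
    (hlex : IsLexMaxWeightedCentreGerm S (Ideal.span {f}) x w ℓ) (hℓ : ℓ = w 0 * ν) (hν : 1 ≤ ν)
    {y : Fin 2 → S} (hy : Ideal.span (Set.range y) = maximalIdeal S) {c : S}
    (hprep : f - c * y 0 ^ ν ∈ weightedMonomialIdeal y w (w 0 * ν + 1)) : False := by
  obtain ⟨-, hwpos, -, hw10, -, -, -, hlexmax, -⟩ := hlex
  have hw1 : 0 < w 1 := hwpos 1
  have hadm : Ideal.span {f} ≤ weightedMonomialIdeal y ![ν * w 0 + 1, ν * w 1] ((ν * w 0 + 1) * ν) := by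
    rw [Ideal.span_singleton_le_iff_mem]
    exact mem_weightedMonomialIdeal_competitor y w hprep
  have h := hlexmax y ![ν * w 0 + 1, ν * w 1] ((ν * w 0 + 1) * ν) hy
    (Fin.forall_fin_two.mpr ⟨Nat.succ_pos _, Nat.mul_pos hν hw1⟩)
    (by simp only [Matrix.cons_val_one, Matrix.cons_val_zero]; nlinarith [hw10])
    (Nat.mul_pos (Nat.succ_pos _) hν) hadm
  simp only [Matrix.cons_val_zero, Matrix.cons_val_one] at h
  rw [hℓ] at h
  rcases h with h | ⟨-, h⟩
  · exact absurd h (by nlinarith [Nat.zero_le (w 0 * ν)])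
  · have : (ν * w 0 + 1) * ν * w 1 = w 0 * ν * (ν * w 1) + ν * w 1 := by ring
    rw [this] at h
    have hpos : 0 < ν * w 1 := Nat.mul_pos hν hw1
    omega

/-! ### The face of a unit expansion for coprime weights -/

/-- **Reindexing the face by `j`.** For coprime `w₀, w₁ ≥ 1`, the exponents `α ∈ Δ` with `w₀α₀ + w₁α₁ = w₀ν` are exactly
the `(ν - w₁ j, w₀ j) ∈ Δ` with `j ≤ ν / w₁` (`w₀ ∣ α₁` by coprimality). [folklore] -/
theorem sum_face_reindex {R : Type*} [AddCommMonoid R] {w₀ w₁ ν : ℕ} (hw₀ : 0 < w₀) (hw₁ : 0 < w₁)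
    (hcop : Nat.Coprime w₀ w₁) (Δ : Finset (Fin 2 → ℕ)) (φ : (Fin 2 → ℕ) → R) :
    ∑ j ∈ (Finset.range (ν / w₁ + 1)).filter (fun j => (![ν - w₁ * j, w₀ * j] : Fin 2 → ℕ) ∈ Δ),
        φ ![ν - w₁ * j, w₀ * j] =
      ∑ α ∈ Δ.filter (fun α => w₀ * α 0 + w₁ * α 1 = w₀ * ν), φ α := by
  classical
  refine Finset.sum_bij (fun j _ => (![ν - w₁ * j, w₀ * j] : Fin 2 → ℕ)) ?_ ?_ ?_ ?_
  · intro j hj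
    obtain ⟨hjr, hjΔ⟩ := Finset.mem_filter.mp hj
    have hjν : w₁ * j ≤ ν := by
      have := Nat.lt_succ_iff.mp (Finset.mem_range.mp hjr)
      rw [mul_comm]; exact (Nat.le_div_iff_mul_le hw₁).mp this
    refine Finset.mem_filter.mpr ⟨hjΔ, ?_⟩
    simp only [Matrix.cons_val_zero, Matrix.cons_val_one]
    have e : w₀ * (ν - w₁ * j) = w₀ * ν - w₀ * (w₁ * j) := Nat.mul_sub _ _ _
    have e' : w₁ * (w₀ * j) = w₀ * (w₁ * j) := by ring
    have hle : w₀ * (w₁ * j) ≤ w₀ * ν := Nat.mul_le_mul_left _ hjν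
    omega
  · intro j₁ _ j₂ _ h
    have := congrFun h 1
    simp only [Matrix.cons_val_one] at this
    exact Nat.eq_of_mul_eq_mul_left hw₀ this
  · intro α hα
    obtain ⟨hαΔ, hαeq⟩ := Finset.mem_filter.mp hα
    -- `w₀ ∣ α 1`
    have hα0 : α 0 ≤ ν := by nlinarith [hαeq, Nat.zero_le (w₁ * α 1)]
    have hdvd : w₀ ∣ α 1 := by
      have h1 : w₀ ∣ w₁ * α 1 := ⟨ν - α 0, by rw [Nat.mul_sub]; omega⟩
      exact hcop.dvd_of_dvd_mul_left h1
    obtain ⟨j, hj⟩ := hdvd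
    have hνj : ν = α 0 + w₁ * j := by
      have h2 : w₀ * (α 0 + w₁ * j) = w₀ * ν := by rw [Nat.mul_add, ← hαeq, hj]; ring
      exact (Nat.eq_of_mul_eq_mul_left hw₀ h2).symm
    have hjν : w₁ * j ≤ ν := by omega
    have hαvec : (![ν - w₁ * j, w₀ * j] : Fin 2 → ℕ) = α := by
      ext i; fin_cases i
      · simp; omega
      · simp [hj]
    refine ⟨j, Finset.mem_filter.mpr ⟨Finset.mem_range.mpr (Nat.lt_succ_of_le ?_), by rw [hαvec]; exact hαΔ⟩, hαvec⟩
    exact (Nat.le_div_iff_mul_le hw₁).mpr (by rw [mul_comm]; exact hjν)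
  · intro j _
    rfl

/-! ### The order drop under the lex-maximal weighted blow-up -/

end LexMaxOrderDrop

end Summit.ResolutionOfSingularities.ResolutionOfSingularities.Theorems

end
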